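import Summits.BirchSwinnertonDyer.BirchSwinnertonDyer.Theorems.Rank2ShaTierKitW16
import Summits.BirchSwinnertonDyer.BirchSwinnertonDyer.Theorems.Rank2ObservatoryTorsionCert
import HarnessLib

/-!
# BirchSwinnertonDyer — rank-2 `Ш[3^∞]` cell: frame «w16-bound» at `p = 3` WITH A TORSION CERTIFICATE
# (reducible `E[3]`, `#E(ℚ)_tors` computed in the kernel by the observatory's `TorsCert`)

HONEST FRAMING (cell `b2b-bsdr2sha`, run/shared/lean/b2b/bsd-rank2-sha/): per-pair certified
theorems «cited hypotheses ∧ certified computation ⇒ `Ш(E/ℚ)[p^∞]` finite of order dividing `p^k`»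
for rank-2 curves at good ordinary primes; NO claim on BSD in rank `≥ 2`, no class-level theorem,
every published input is a NAMED HYPOTHESIS of the tree (nothing is asserted or minted here).

`Rank2ShaTierKitW16.lean` books a REDUCIBLE `p = 3` row (Wuthrich 2014 Thm. 16, `ord_3 #Ш ≤ a + 2 +
2·ord_3 #E(ℚ)_tors − 2·ord_3 #Ẽ(𝔽₃) − ord_3 ∏c_ℓ − b`) when `3 ∤ #E(ℚ)_tors`. The torsion term is LIVE on
the rows with rational `3`-torsion (cell table: `E(ℚ)_tors ≅ ℤ/3` on 265 of the 664 reducible `p = 3`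
cells). The observatory's kernel torsion certificates (`Rank2ObservatoryTorsionCert.lean`: format
`TorsCert`, ONE soundness theorem `torsionOrder_of_check : c.check V = true → #E(ℚ)_tors = c.order`,
kinds trivial / `ℤ/2` / `ℤ/3` / `ℤ/4` / `ℤ/2 × ℤ/2`) compute `#E(ℚ)_tors` EXACTLY, so here the torsion
term is read off a checking certificate `c`:

* `ShaRow.w16C₃` — for a row passing `checkR₃` (good ordinary at `3`, minimal model, exact Tamagawa,
  `E[3]` reducible by a rational `Ψ₃` root) and a `TorsCert` `c` with `c.check R.e = true`:
  `rank = 2 ∧ Ш(E/ℚ)[3^∞] finite ∧ Reg_3 ≠ 0 ∧ ord_3 #Ш(E/ℚ)[3^∞] ≤ R.k + 2·ord_3 (c.order)`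
  (`R.k` = the kato `k`-formula of the row; `c.order ∈ {1, 2, 3, 4}`); `w16C₃_eq_one` when that bound is `≤ 0`;
* READERS `booked_w16COne₃` (certificate `R.checkR₃ = true ∧ c.check R.e = true ∧
  R.k + 2·ord_3 c.order ≤ 0 ∧ 2 ≤ rank`) and `booked_w16CLe₃` (without the `≤ 0` conjunct), binders
  exactly those of `booked_w16One₃` (hW16, hS, h26, the EXPLICIT optimal datum, L-datum, height datum).

References: C. Wuthrich, Doc. Math. 19 (2014), Thm. 16 [Wuthrich2014]; A. Agashe, K. Ribet, W. Stein,
PAMQ 2 (2006), Thm. 2.6 [AgasheRibetStein2006]; J. E. Cremona, *Algorithms* (1997), §3.3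
[CremonaAlgorithms1997]; J. H. Silverman, AEC (2009), VII.3.1(b) [SilvermanAEC2009]; W. Stein,
C. Wuthrich, Math. Comp. 82 (2013), Alg. 11.1 [SteinWuthrich2013].
-/

set_option autoImplicit false

-- single-conjunct summit: `Summit.BirchSwinnertonDyer.BirchSwinnertonDyer.…` repeats the name by design
set_option linter.dupNamespace false

noncomputable section

open scoped Classical MatrixGroups ModularForm

open CongruenceSubgroup WeierstrassCurve Literature.NumberTheory.EllipticCurves
  Literature.NumberTheory.EllipticCurves.ModularForms
  Literature.NumberTheory.EllipticCurves.Rank1Residual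
  Summit.BirchSwinnertonDyer.BirchSwinnertonDyer.Rank2Observatory

namespace Summit.BirchSwinnertonDyer.BirchSwinnertonDyer.Rank2Sha

namespace ShaRow

variable {R : ShaRow}

/-- At a row whose integer model carries a checking torsion certificate `c`, `#E(ℚ)_tors = c.order`
(the observatory's `torsionOrder_of_check`, transported from `e.map (Int.castRingHom ℚ)` to `e ⊗ ℚ`).
[cite: CremonaAlgorithms1997, §3.3] [cite: SilvermanAEC2009, VII.3.1(b)] -/
theorem torsionOrder_eq_of_torsCert {c : TorsCert} (hc : c.check R.e = true) :
    (R.e.baseChange ℚ).torsionOrder = c.order := by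
  rw [baseChange_int_eq_map]
  exact torsionOrder_of_check R.e c hc

/-- **TIER ROW THEOREM at `p = 3`, frame «w16-bound», WITH A TORSION CERTIFICATE.** For a compact row
`R` passing `checkR₃` and a torsion certificate `c` with `c.check R.e = true`, GIVEN `hW16` (Wuthrich
2014 Thm. 16), `hS` (PRS), `h26` (Agashe–Ribet–Stein Thm. 2.6), an EXPLICIT lattice-optimal
parametrisation datum at a level `N ≤ 130000`, the rank certificate, the L-datum and THE canonical
`3`-adic height datum: `rank_ℤ E(ℚ) = 2`, `Ш(E/ℚ)[3^∞]` finite, `Reg_3 ≠ 0`, and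
`ord_3 #Ш(E/ℚ)[3^∞] ≤ R.k + 2·ord_3 (c.order)` (`#E(ℚ)_tors = c.order` in the kernel). Per pair; NOT a
class theorem. [cite: Wuthrich2014, Thm. 16 (p. 397)] [cite: AgasheRibetStein2006, Thm. 2.6]
[cite: CremonaAlgorithms1997, §3.3] [cite: SteinWuthrich2013, §§3–4 and Alg. 11.1] -/
theorem w16C₃ (h : R.checkR₃ = true) {c : TorsCert} (hc : c.check R.e = true)
    [(R.e.baseChange ℚ).IsElliptic] [(R.e.baseChange ℚ).IsGloballyMinimal]
    (hW16 : Wuthrich2014.charIdeal_dvd_padicLFunction) (hS : Schneider1985_order_charGenerator_odd)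
    (h26 : AgasheRibetStein2006.cremona_abs_maninConstant_eq_one_of_level_le)
    {N : ℕ} [NeZero N] (D : ModularParametrizationData (R.e.baseChange ℚ) N)
    (hopt : ∀ z ∈ D.L.lattice, ∃ w ∈ periodLattice D.f, z = D.c * w) (hN : N ≤ 130000)
    (hlow : 2 ≤ (R.e.baseChange ℚ).mordellWeilRank)
    (hLp : PowerSeries.coeff 2 (padicLFunction D.f (unitRoot (R.e.baseChange ℚ) 3 : ℚ_[3])) ≠ 0)
    (hcoeff : (PowerSeries.coeff 2
      (padicLFunction D.f (unitRoot (R.e.baseChange ℚ) 3 : ℚ_[3]))).valuation = R.a)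
    (Dh : PAdicHeightData (R.e.baseChange ℚ) 3) (hDh : Dh.IsCanonical)
    (hreg : (padicRegulator Dh).valuation = R.b) :
    (R.e.baseChange ℚ).mordellWeilRank = 2 ∧
      Finite (AddCommGroup.primaryComponent (R.e.baseChange ℚ).sha 3) ∧ SchneiderConjecture Dh ∧
      (padicValNat 3 (Nat.card (AddCommGroup.primaryComponent (R.e.baseChange ℚ).sha 3)) : ℤ) ≤
        R.k + 2 * padicValNat 3 c.order := by
  have hb := check₃_of_checkR₃ h
  have hordin := isOrdinaryAt₃ hb
  have hred := not_irr_of_checkR₃ h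
  obtain ⟨hr, hfin, hSch, hle⟩ := padicBSD_inequality_of_wuthrich16_odd_of_coeff_ne_zero_of_optimal
    hW16 hS h26 (R.e.baseChange ℚ) 3 (by decide) hordin.1 hordin.2 hred D hopt hN Dh hDh hlow hLp
  haveI := hfin
  refine ⟨hr, hfin, hSch, ?_⟩
  have hk := padicValNat_card_shaPrimary_le_of_valuation_le (R.e.baseChange ℚ) 3 (by decide) hordin D.f
    Dh hSch hLp hle hcoeff hreg
  rw [torsionOrder_eq_of_torsCert hc, (reductionPointCount_eq_and_tamagawaProduct_eq₃ hb).1,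
    (reductionPointCount_eq_and_tamagawaProduct_eq₃ hb).2] at hk
  rw [ShaRow.k, p_eq_three hb]
  push_cast at hk ⊢
  linarith

/-- **`p = 3`, frame «w16-bound» with a torsion certificate, bound `≤ 0`: `Ш(E/ℚ)[3^∞] = 0`.**
[cite: Wuthrich2014, Thm. 16 (p. 397)] [cite: SteinWuthrich2013, Thm. 1.1 and Alg. 11.1] -/
theorem w16C₃_eq_one (h : R.checkR₃ = true) {c : TorsCert} (hc : c.check R.e = true)
    [(R.e.baseChange ℚ).IsElliptic] [(R.e.baseChange ℚ).IsGloballyMinimal]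
    (hW16 : Wuthrich2014.charIdeal_dvd_padicLFunction) (hS : Schneider1985_order_charGenerator_odd)
    (h26 : AgasheRibetStein2006.cremona_abs_maninConstant_eq_one_of_level_le)
    {N : ℕ} [NeZero N] (D : ModularParametrizationData (R.e.baseChange ℚ) N)
    (hopt : ∀ z ∈ D.L.lattice, ∃ w ∈ periodLattice D.f, z = D.c * w) (hN : N ≤ 130000)
    (hlow : 2 ≤ (R.e.baseChange ℚ).mordellWeilRank)
    (hLp : PowerSeries.coeff 2 (padicLFunction D.f (unitRoot (R.e.baseChange ℚ) 3 : ℚ_[3])) ≠ 0)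
    (hcoeff : (PowerSeries.coeff 2
      (padicLFunction D.f (unitRoot (R.e.baseChange ℚ) 3 : ℚ_[3]))).valuation = R.a)
    (Dh : PAdicHeightData (R.e.baseChange ℚ) 3) (hDh : Dh.IsCanonical)
    (hreg : (padicRegulator Dh).valuation = R.b) (hk0 : R.k + 2 * padicValNat 3 c.order ≤ 0) :
    (R.e.baseChange ℚ).mordellWeilRank = 2 ∧
      Finite (AddCommGroup.primaryComponent (R.e.baseChange ℚ).sha 3) ∧ SchneiderConjecture Dh ∧
      Nat.card (AddCommGroup.primaryComponent (R.e.baseChange ℚ).sha 3) = 1 := by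
  obtain ⟨hr, hfin, hSch, hle⟩ := w16C₃ h hc hW16 hS h26 D hopt hN hlow hLp hcoeff Dh hDh hreg
  haveI := hfin
  have hv0 : padicValNat 3 (Nat.card (AddCommGroup.primaryComponent (R.e.baseChange ℚ).sha 3)) = 0 := by
    have := hle.trans hk0
    omega
  have hndvd : ¬ 3 ∣ Nat.card (AddCommGroup.primaryComponent (R.e.baseChange ℚ).sha 3) := by
    rcases padicValNat.eq_zero_iff.mp hv0 with h1 | h0 | hnd
    · exact absurd h1 (by decide)
    · exact absurd h0 Nat.card_pos.ne'
    · exact hnd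
  exact ⟨hr, hfin, hSch, natCard_primaryComponent_eq_one 3 hndvd⟩

/-- **READER at `p = 3`, frame «w16-bound» with a torsion certificate, V-BOUND 0** («`Ш(E/ℚ)[3^∞] = 0`»):
certificate `R.checkR₃ = true ∧ c.check R.e = true ∧ R.k + 2·ord_3 c.order ≤ 0 ∧ 2 ≤ rank`.
[cite: Wuthrich2014, Thm. 16 (p. 397)] [cite: AgasheRibetStein2006, Thm. 2.6] [cite: CremonaAlgorithms1997, §3.3]
[cite: SteinWuthrich2013, Alg. 11.1 and Prop. 11.2] -/
theorem booked_w16COne₃ {c : TorsCert}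
    (h : R.checkR₃ = true ∧ c.check R.e = true ∧ R.k + 2 * padicValNat 3 c.order ≤ 0 ∧
      2 ≤ (R.e.baseChange ℚ).mordellWeilRank) :
    haveI := (isElliptic_and_isGloballyMinimal₃ (check₃_of_checkR₃ h.1)).1
    haveI := (isElliptic_and_isGloballyMinimal₃ (check₃_of_checkR₃ h.1)).2
    ∀ (_hW16 : Wuthrich2014.charIdeal_dvd_padicLFunction) (_hS : Schneider1985_order_charGenerator_odd)
      (_h26 : AgasheRibetStein2006.cremona_abs_maninConstant_eq_one_of_level_le)
      {N : ℕ} [NeZero N] (D : ModularParametrizationData (R.e.baseChange ℚ) N)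
      (_hopt : ∀ z ∈ D.L.lattice, ∃ w ∈ periodLattice D.f, z = D.c * w) (_hN : N ≤ 130000)
      (_hLp : PowerSeries.coeff 2 (padicLFunction D.f (unitRoot (R.e.baseChange ℚ) 3 : ℚ_[3])) ≠ 0)
      (_hcoeff : (PowerSeries.coeff 2
        (padicLFunction D.f (unitRoot (R.e.baseChange ℚ) 3 : ℚ_[3]))).valuation = R.a)
      (Dh : PAdicHeightData (R.e.baseChange ℚ) 3) (_hDh : Dh.IsCanonical)
      (_hreg : (padicRegulator Dh).valuation = R.b),
      (R.e.baseChange ℚ).mordellWeilRank = 2 ∧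
        Finite (AddCommGroup.primaryComponent (R.e.baseChange ℚ).sha 3) ∧ SchneiderConjecture Dh ∧
        Nat.card (AddCommGroup.primaryComponent (R.e.baseChange ℚ).sha 3) = 1 := by
  intro hW16 hS h26 N _ D hopt hN hLp hcoeff Dh hDh hreg
  haveI := (isElliptic_and_isGloballyMinimal₃ (check₃_of_checkR₃ h.1)).1
  haveI := (isElliptic_and_isGloballyMinimal₃ (check₃_of_checkR₃ h.1)).2
  exact w16C₃_eq_one h.1 h.2.1 hW16 hS h26 D hopt hN h.2.2.2 hLp hcoeff Dh hDh hreg h.2.2.1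

/-- **READER at `p = 3`, frame «w16-bound» with a torsion certificate, V-BOUND `b`**: certificate
`R.checkR₃ = true ∧ c.check R.e = true ∧ 2 ≤ rank`; conclusion `ord_3 #Ш(E/ℚ)[3^∞] ≤ R.k + 2·ord_3 c.order`.
[cite: Wuthrich2014, Thm. 16 (p. 397)] [cite: AgasheRibetStein2006, Thm. 2.6] [cite: CremonaAlgorithms1997, §3.3]
[cite: SteinWuthrich2013, Alg. 11.1 and Prop. 11.2] -/
theorem booked_w16CLe₃ {c : TorsCert}
    (h : R.checkR₃ = true ∧ c.check R.e = true ∧ 2 ≤ (R.e.baseChange ℚ).mordellWeilRank) :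
    haveI := (isElliptic_and_isGloballyMinimal₃ (check₃_of_checkR₃ h.1)).1
    haveI := (isElliptic_and_isGloballyMinimal₃ (check₃_of_checkR₃ h.1)).2
    ∀ (_hW16 : Wuthrich2014.charIdeal_dvd_padicLFunction) (_hS : Schneider1985_order_charGenerator_odd)
      (_h26 : AgasheRibetStein2006.cremona_abs_maninConstant_eq_one_of_level_le)
      {N : ℕ} [NeZero N] (D : ModularParametrizationData (R.e.baseChange ℚ) N)
      (_hopt : ∀ z ∈ D.L.lattice, ∃ w ∈ periodLattice D.f, z = D.c * w) (_hN : N ≤ 130000)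
      (_hLp : PowerSeries.coeff 2 (padicLFunction D.f (unitRoot (R.e.baseChange ℚ) 3 : ℚ_[3])) ≠ 0)
      (_hcoeff : (PowerSeries.coeff 2
        (padicLFunction D.f (unitRoot (R.e.baseChange ℚ) 3 : ℚ_[3]))).valuation = R.a)
      (Dh : PAdicHeightData (R.e.baseChange ℚ) 3) (_hDh : Dh.IsCanonical)
      (_hreg : (padicRegulator Dh).valuation = R.b),
      (R.e.baseChange ℚ).mordellWeilRank = 2 ∧
        Finite (AddCommGroup.primaryComponent (R.e.baseChange ℚ).sha 3) ∧ SchneiderConjecture Dh ∧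
        (padicValNat 3 (Nat.card (AddCommGroup.primaryComponent (R.e.baseChange ℚ).sha 3)) : ℤ) ≤
          R.k + 2 * padicValNat 3 c.order := by
  intro hW16 hS h26 N _ D hopt hN hLp hcoeff Dh hDh hreg
  haveI := (isElliptic_and_isGloballyMinimal₃ (check₃_of_checkR₃ h.1)).1
  haveI := (isElliptic_and_isGloballyMinimal₃ (check₃_of_checkR₃ h.1)).2
  exact w16C₃ h.1 h.2.1 hW16 hS h26 D hopt hN h.2.2 hLp hcoeff Dh hDh hreg

end ShaRow

end Summit.BirchSwinnertonDyer.BirchSwinnertonDyer.Rank2Sha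

end
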